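import Summits.QuantumFields.BalabanUV.Beta.FP.TowerFWeightRecLoc
import Summits.QuantumFields.BalabanUV.Beta.CoclosedCovectorCompositeRows

/-!
# `BalabanUV.Beta.FP.TowerFWeightCoclosedPairing` — row D1 ∕ (C1) OWNER «beta-an2», PART 98, ROUTE T (β1), option (3a), FINDING AN2-85-1 (B): **THE TRUE TOP-STEP WEIGHT
# PAIRED WITH A BOUNDED CO-CLOSED MIDDLE COVECTOR** — `⟨ψ, wFRec … n μ y⟩ = ((Lc⁴)⁻¹)^(n+1) · ⟨ψ, contourSum (Lc^(n+1)) (respCol … μ y)⟩` (the tower-below's composite rows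
# DROP OUT on co-closed covectors: an2 g63 PART 20 `CoclosedCovectorCompositeRows.lip1_compLinKer_linKerAt_of_bounded ∕ …_symLinKerAt_…` summed over the finest bond with the
# decaying response column as weight — the one analytic step is the exchange of the middle-bond and finest-bond sums, §1), and `contourSum` of the response column is
# `contourSum` of the σ-chart's `ℋ`-column MINUS a COARSE GRADIENT (lit `AffineAveraging.contourSum_dz`), which a bounded co-closed covector does not see
# (an2 g60 `CoclosedCovectorLinearRows.lip1_dz_eq_zero_of_bounded`; that last step is the NEXT file `TowerFWeightGaugeDropout`) — the DUAL form of the END's displayed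
# `hgauge`, row side; journal [AN2-G85-W-11] FINDING AN2-85-1
# (β-function cell `pub-balaban`, BINDER-OWNERS row D1)

WHY (design level; [AN2-G85-W-11]).  Under option (3a) the END displays `hgauge j` («the true weight minus `α·wStep` is a lattice gradient of a potential `ζ`», by value
A2-HQF0).  What the Ward bridge (road `DressedEntryWardInvariance`) actually consumes is weaker: the defect weight must be ORTHOGONAL to every bounded co-closed covector
(a gradient is, by `lip1_dz_eq_zero_of_bounded`).  This file proves the row's half of that DUAL statement BY NAME up to the one column letter (K1ᶜ) of K1.md §6's family:
the composite rows and the record gauge function disappear on co-closed covectors, leaving the straight `Lc^(n+1)`-contour sum of the σ-chart's column.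

WHAT ([folklore]; 0 `def`): §1 `tsum_swap_window` — a bounded kernel with uniformly finite row supports, a bounded covector and absolutely summable weights: the middle-bond
pairing and the finest-bond sum commute (product summability by `summable_prod_of_nonneg` on an indicator majorant + `Summable.tsum_comm`); §2 `tsum_straightCount_mul_eq_contourSum`
(the rows of `contourSum` ARE the straight counts, `tsum` form); §3 **`lip1_wFRec_of_lip1_compLinKer`** (generic brick, PART 20's conclusion shape as hypothesis),
**`lip1_wFRec_rooted ∕ lip1_wFRec_sym`** (`⟨ψ, wFRec⟩ = ((Lc⁴)⁻¹)^(n+1)·⟨ψ, contourSum (respCol)⟩`, PART 20 at both row tokens).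
WHAT THIS IS NOT: not (K1ᶜ) (`⟨ψ, contourSum (colH (AN …))⟩` vs `⟨ψ, wStep …⟩` — by value K1.md∕A2-HQF0, displayed); not the dual Ward bridge (road side); nothing of the END
instantiated; nothing of Bałaban's asserted, valued or discharged; 0 estimates beyond [folklore] summability bookkeeping; 0∕4 row-D1 binders; NOT (C1), NOT D1, NEVER «G-an2-4
closed», NOT BetaPertH, NOT continuum, NOT Clay.

HONEST DEPENDENCY (page 1, mandatory): continuum YM on T⁴ ⇐ BetaPertH ∧ nine spine estimates (0/9 proved); BetaPertH ⇐ (D1) ∧ (D4) ∧ CAP+tail;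
G-an2-4 gates asym, D1 and NE2/3/4.  HONEST FRAMING (cell contract, verbatim): «discharging `BetaPertH` makes Bałaban's UV stability UNCONDITIONAL —
a real constructive-QFT result; it is NOT the continuum limit and NOT the Clay problem.»  ABSOLUTE RULE (cell charter, verbatim): «No internally-minted
statement may enter as a cited fact. Every hypothesis is either kernel-proved in this package or a verbatim quotation of a PUBLISHED theorem with page
reference. The manuscript(s) under audit are NOT citable for their own disputed steps — they are the thing under adjudication; programme-internal
(2001/route/tribunal) claims are never citable.»  Row D1 ∕ (C1) OWNER «beta-an2», b2b-balaban-beta-an2 gen 85, 2026-08-30.  No existing file touched.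
-/

noncomputable section

open Finset
open scoped BigOperators
open Literature.MathematicalPhysics.QuantumFieldTheory
open Literature.MathematicalPhysics.QuantumFieldTheory.Balaban1983to89
open Literature.MathematicalPhysics.QuantumFieldTheory.Balaban1983to89.Beta
open B12Sec2to5 (l1 l1_nonneg)
open ExpKernelCalculus (l1_sub_triangle l1_sub_symm)
open AffineAveraging (Form0 Form1 Site box toSite unitVec dz codiff₁ contourSum blockSum contourSum_dz)
open AveragingContoursRooted (ctrOff ctrOff_mem_box)
open AveragingHessianKernels (Bond Near straightCount ell)
open AveragingHessianKernelsRooted (linKerAt)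
open OneStepKernelFamily (colH)
open KKTFluctuationEnergy (lip1)
open Summit.QuantumFields.BalabanUV.Beta.AxialDressingRooted (one_le_of_neZero)
open Summit.QuantumFields.BalabanUV.Beta.SymAveragingHessianCounts (symLinKerAt)
open Summit.QuantumFields.BalabanUV.Beta.CompositeVertexKernelRec (compLinKer winF wid mem_winF_iff compLinKer_eq_zero abs_compLinKer_le)
open Summit.QuantumFields.BalabanUV.Beta.CompositeVertexKernelLiftKernel (mem_piFinset_of_mem_winF)
open Summit.QuantumFields.BalabanUV.Beta.CompositeOneShotJetData (Roots Roots.ctr AN)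
open Summit.QuantumFields.BalabanUV.Beta.GAN24.FineReadoutCauchyFrame (toSite_mem_range)
open Summit.QuantumFields.BalabanUV.Beta.FP.TorusCompositeObjects (bigRatio)
open Summit.QuantumFields.BalabanUV.Beta.FP.TorusCompositeObjectsG (StepRows)
open Summit.QuantumFields.BalabanUV.Beta.FP.TowerDoorRecordDefsG (lamRecG)
open Summit.QuantumFields.BalabanUV.Beta.FP.TowerFWeightRecDefs
open Summit.QuantumFields.BalabanUV.Beta.FP.TowerFWeightRecLoc (exists_abs_respCol_le)
open Summit.QuantumFields.BalabanUV.Beta.CoclosedCovectorLinearRows (lip1_dz_eq_zero_of_bounded)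
open Summit.QuantumFields.BalabanUV.Beta.CoclosedCovectorLinearRowsNear (straightCount_eq_zero_of_not_near mem_piFinset_of_near summable_of_near)
open Summit.QuantumFields.BalabanUV.Beta.CoclosedCovectorCompositeRows (card_supportBox sum_mul_straightCount_eq_contourSum lip1_compLinKer_linKerAt_of_bounded
  lip1_compLinKer_symLinKerAt_of_bounded)

namespace Summit.QuantumFields.BalabanUV.Beta.FP.TowerFWeightCoclosedPairing

/-! ## §1 Exchanging the middle-bond pairing with the finest-bond sum -/

section Swap

/-- [folklore] product summability of `(u, t) ↦ ψ c t · K (κ′,u) c t · R κ′ u` on an indicator majorant: the kernel is bounded by `B` and, for every finest bond, supported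
(in the middle site) in a finite set of at most `Cb` elements; the covector is bounded by `M`; the weight is absolutely summable. -/
theorem summable_uncurry_window {K : Bond (3 + 1) → Fin (3 + 1) → Site (3 + 1) → ℝ} {B : ℝ} (hB0 : 0 ≤ B) (hB : ∀ f c t, |K f c t| ≤ B)
    (S : Bond (3 + 1) → Finset (Site (3 + 1))) {Cb : ℝ} (hS : ∀ f, ((S f).card : ℝ) ≤ Cb) (hK0 : ∀ f c t, t ∉ S f → K f c t = 0)
    {ψ : Form1 (3 + 1) ℝ} {M : ℝ} (hM : 0 ≤ M) (hψ : ∀ c t, |ψ c t| ≤ M)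
    {R : Fin (3 + 1) → Site (3 + 1) → ℝ} (hR : ∀ κ', Summable fun u => |R κ' u|) (c κ' : Fin (3 + 1)) :
    Summable (fun p : Site (3 + 1) × Site (3 + 1) => ψ c p.2 * (K (κ', p.1) c p.2 * R κ' p.1)) := by
  classical
  -- majorant g (u, t) := M·B·|R κ' u| · [t ∈ S (κ',u)]
  set g : Site (3 + 1) × Site (3 + 1) → ℝ := fun p => M * B * |R κ' p.1| * (if p.2 ∈ S (κ', p.1) then 1 else 0) with hg
  have hg0 : 0 ≤ g := fun p => by
    simp only [hg, Pi.zero_apply]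
    split_ifs <;> positivity
  have hgsum : Summable g := by
    rw [summable_prod_of_nonneg hg0]
    constructor
    · intro u
      refine summable_of_ne_finset_zero (s := S (κ', u)) fun t ht => ?_
      simp only [hg, if_neg ht, mul_zero]
    · have hrow : ∀ u, ∑' t, g (u, t) = M * B * |R κ' u| * ((S (κ', u)).card : ℝ) := by
        intro u
        rw [tsum_eq_sum (s := S (κ', u)) (fun t ht => by simp only [hg, if_neg ht, mul_zero])]
        rw [Finset.sum_congr rfl fun t ht => show g (u, t) = M * B * |R κ' u| by simp only [hg, if_pos ht, mul_one]]
        rw [Finset.sum_const, nsmul_eq_mul, mul_comm]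
      simp only [hrow]
      refine Summable.of_nonneg_of_le (fun u => by positivity) (fun u => ?_) (((hR κ').mul_left (M * B)).mul_right Cb)
      have h1 : 0 ≤ M * B * |R κ' u| := by positivity
      calc M * B * |R κ' u| * ((S (κ', u)).card : ℝ) ≤ M * B * |R κ' u| * Cb := mul_le_mul_of_nonneg_left (hS _) h1
        _ = M * B * |R κ' u| * Cb := rfl
  refine hgsum.of_norm_bounded fun p => ?_
  rw [Real.norm_eq_abs, abs_mul, abs_mul]
  by_cases ht : p.2 ∈ S (κ', p.1)
  · simp only [hg, if_pos ht, mul_one]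
    calc |ψ c p.2| * (|K (κ', p.1) c p.2| * |R κ' p.1|) ≤ M * (B * |R κ' p.1|) :=
          mul_le_mul (hψ _ _) (mul_le_mul_of_nonneg_right (hB _ _ _) (abs_nonneg _)) (by positivity) hM
      _ = M * B * |R κ' p.1| := by ring
  · rw [hK0 _ _ _ ht, abs_zero, zero_mul, mul_zero]
    exact hg0 p

/-- [folklore] **`tsum_swap_window` — THE MIDDLE-BOND PAIRING AND THE FINEST-BOND SUM COMMUTE**: for a bounded window kernel `K`, a bounded covector `ψ` and absolutely
summable weights `R`,
`Σ'_t Σ_c ψ c t · (Σ_{κ′} Σ'_u K (κ′,u) c t · R κ′ u) = Σ_{κ′} Σ'_u R κ′ u · (Σ'_t Σ_c ψ c t · K (κ′,u) c t)`. -/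
theorem tsum_swap_window {K : Bond (3 + 1) → Fin (3 + 1) → Site (3 + 1) → ℝ} {B : ℝ} (hB0 : 0 ≤ B) (hB : ∀ f c t, |K f c t| ≤ B)
    (S : Bond (3 + 1) → Finset (Site (3 + 1))) {Cb : ℝ} (hS : ∀ f, ((S f).card : ℝ) ≤ Cb) (hK0 : ∀ f c t, t ∉ S f → K f c t = 0)
    {ψ : Form1 (3 + 1) ℝ} {M : ℝ} (hM : 0 ≤ M) (hψ : ∀ c t, |ψ c t| ≤ M)
    {R : Fin (3 + 1) → Site (3 + 1) → ℝ} (hR : ∀ κ', Summable fun u => |R κ' u|) :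
    ∑' t : Site (3 + 1), ∑ c : Fin (3 + 1), ψ c t * (∑ κ' : Fin (3 + 1), ∑' u : Site (3 + 1), K (κ', u) c t * R κ' u)
      = ∑ κ' : Fin (3 + 1), ∑' u : Site (3 + 1), R κ' u * (∑' t : Site (3 + 1), ∑ c : Fin (3 + 1), ψ c t * K (κ', u) c t) := by
  -- the common summand
  set F : Fin (3 + 1) → Fin (3 + 1) → Site (3 + 1) → Site (3 + 1) → ℝ := fun c κ' t u => ψ c t * (K (κ', u) c t * R κ' u) with hF
  have hsum : ∀ c κ', Summable (fun p : Site (3 + 1) × Site (3 + 1) => F c κ' p.2 p.1) :=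
    fun c κ' => summable_uncurry_window hB0 hB S hS hK0 hM hψ hR c κ'
  -- (t,u)-order summability of the uncurried family
  have hsumTU : ∀ c κ', Summable (Function.uncurry fun t u => F c κ' t u) := by
    intro c κ'
    have h := (Equiv.prodComm (Site (3 + 1)) (Site (3 + 1))).summable_iff.2 (hsum c κ')
    refine h.congr fun p => ?_
    rfl
  have hsumUT : ∀ c κ', Summable (Function.uncurry fun u t => F c κ' t u) := by
    intro c κ'
    refine (hsum c κ').congr fun p => ?_
    rfl
  -- LEFT: push ψ inside, split the finite sums out of the tsum
  have hL : ∀ t, ∑ c : Fin (3 + 1), ψ c t * (∑ κ' : Fin (3 + 1), ∑' u : Site (3 + 1), K (κ', u) c t * R κ' u)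
      = ∑ c : Fin (3 + 1), ∑ κ' : Fin (3 + 1), ∑' u : Site (3 + 1), F c κ' t u := by
    intro t
    refine Finset.sum_congr rfl fun c _ => ?_
    rw [Finset.mul_sum]
    refine Finset.sum_congr rfl fun κ' _ => ?_
    rw [← tsum_mul_left]
  have hLt : ∀ c κ', Summable fun t => ∑' u : Site (3 + 1), F c κ' t u := fun c κ' => (hsumTU c κ').prod
  rw [tsum_congr hL, Summable.tsum_finsetSum (fun c _ => summable_sum fun κ' _ => hLt c κ')]
  simp_rw [Summable.tsum_finsetSum (fun κ' _ => hLt _ κ')]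
  -- RIGHT: push R inside, split the finite sum out of the inner tsum, then out of the outer one
  have hR1 : ∀ κ' u, R κ' u * (∑' t : Site (3 + 1), ∑ c : Fin (3 + 1), ψ c t * K (κ', u) c t)
      = ∑ c : Fin (3 + 1), ∑' t : Site (3 + 1), F c κ' t u := by
    intro κ' u
    rw [← tsum_mul_left]
    simp_rw [Finset.mul_sum]
    rw [Summable.tsum_finsetSum (fun c _ => ?_)]
    · refine Finset.sum_congr rfl fun c _ => tsum_congr fun t => ?_
      simp only [hF]; ring
    · exact summable_of_ne_finset_zero (s := S (κ', u)) fun t ht => by rw [hK0 _ _ _ ht, mul_zero, mul_zero]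
  have hRu : ∀ c κ', Summable fun u => ∑' t : Site (3 + 1), F c κ' t u := fun c κ' => (hsumUT c κ').prod
  simp_rw [hR1]
  rw [Finset.sum_congr rfl fun κ' _ => Summable.tsum_finsetSum (fun c _ => hRu c κ'), Finset.sum_comm]
  refine Finset.sum_congr rfl fun κ' _ => Finset.sum_congr rfl fun c _ => ?_
  -- the exchange itself
  exact ((hsumTU c κ').tsum_comm).symm

end Swap

/-! ## §2 The rows of `contourSum` are the straight counts (`tsum` form) -/

section Contour

/-- [folklore] for a fixed middle bond `(ν, w)` the straight count `u ↦ straightCount N ν w (κ′, u)` vanishes off the window `Near N w`. -/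
theorem straightCount_eq_zero_of_not_near' {N : ℕ} (ν : Fin (3 + 1)) (w : Site (3 + 1)) {κ' : Fin (3 + 1)} {u : Site (3 + 1)} (h : ¬ Near N w u) :
    straightCount N ν w (κ', u) = 0 :=
  straightCount_eq_zero_of_not_near ν (u := (κ', u)) h

/-- [folklore] the window `Near N w` as a finite set of fine sites. -/
theorem mem_nearBox_of_near {N : ℕ} {w u : Site (3 + 1)} (h : Near N w u) :
    u ∈ Fintype.piFinset fun i => Finset.Icc ((N : ℤ) * w i) ((N : ℤ) * w i + (2 * N - 1)) := by
  rw [Fintype.mem_piFinset]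
  intro i
  exact Finset.mem_Icc.2 (h i)

/-- [folklore] **`tsum_straightCount_mul_eq_contourSum`**: `Σ_{κ′} Σ'_u straightCount N ν w (κ′,u) · R κ′ u = contourSum N R ν w` for ANY weight `R` (the count row of a middle bond
is finitely supported; lit `contourSum`'s straight contours enumerate exactly the counted bonds). -/
theorem tsum_straightCount_mul_eq_contourSum (N : ℕ) (R : Form1 (3 + 1) ℝ) (ν : Fin (3 + 1)) (w : Site (3 + 1)) :
    ∑ κ' : Fin (3 + 1), ∑' u : Site (3 + 1), (straightCount N ν w (κ', u) : ℝ) * R κ' u = contourSum N R ν w := by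
  classical
  set T : Finset (Site (3 + 1)) := Fintype.piFinset fun i => Finset.Icc ((N : ℤ) * w i) ((N : ℤ) * w i + (2 * N - 1)) with hT
  have hfin : ∀ κ', ∑' u : Site (3 + 1), (straightCount N ν w (κ', u) : ℝ) * R κ' u
      = ∑ u ∈ T, (straightCount N ν w (κ', u) : ℝ) * R κ' u := by
    intro κ'
    exact tsum_eq_sum fun u hu => by
      rw [straightCount_eq_zero_of_not_near' ν w (fun h => hu (mem_nearBox_of_near h)), Int.cast_zero, zero_mul]
  simp_rw [hfin]
  -- truncate the weight to the window: PART 20's finite-support row identity applies, and `contourSum` reads only window bonds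
  set F : Form1 (3 + 1) ℝ := fun κ u => if u ∈ T then R κ u else 0 with hF
  have hG : ∀ (κ : Fin (3 + 1)) (s : Site (3 + 1)), (κ, s) ∉ (Finset.univ : Finset (Fin (3 + 1))) ×ˢ T → F κ s = 0 := by
    intro κ s hs
    have hs' : s ∉ T := fun h => hs (Finset.mem_product.2 ⟨Finset.mem_univ _, h⟩)
    simp only [hF, if_neg hs']
  have h := sum_mul_straightCount_eq_contourSum (L := N) F ((Finset.univ : Finset (Fin (3 + 1))) ×ˢ T) hG ν w
  rw [Finset.sum_product] at h
  have hmem : ∀ b ∈ box (3 + 1) N, ∀ s ∈ Finset.range N, (N : ℤ) • w + toSite b + (s : ℤ) • unitVec ν ∈ T := by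
    intro b hb s hs
    rw [hT, Fintype.mem_piFinset]
    intro i
    have hb' : ∀ j, b j < N := by simpa [AffineAveraging.box, Fintype.mem_piFinset, Finset.mem_range] using hb
    have h1 : (b i : ℤ) + 1 ≤ (N : ℤ) := by exact_mod_cast hb' i
    have h2 : (s : ℤ) + 1 ≤ (N : ℤ) := by exact_mod_cast Finset.mem_range.1 hs
    have h3 : (0 : ℤ) ≤ (b i : ℤ) := Int.natCast_nonneg _
    have h4 : (0 : ℤ) ≤ (s : ℤ) := Int.natCast_nonneg _
    simp only [Finset.mem_Icc, Pi.add_apply, Pi.smul_apply, smul_eq_mul, AffineAveraging.unitVec_apply, AffineAveraging.toSite]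
    by_cases hi : i = ν
    · rw [if_pos hi]; constructor <;> linarith
    · rw [if_neg hi]; constructor <;> linarith
  have hFR : contourSum N F ν w = contourSum N R ν w := by
    simp only [contourSum]
    refine sum_congr rfl fun b hb => sum_congr rfl fun s hs => ?_
    simp only [hF, if_pos (hmem b hb s hs)]
  calc ∑ κ' : Fin (3 + 1), ∑ u ∈ T, (straightCount N ν w (κ', u) : ℝ) * R κ' u
      = ∑ κ' : Fin (3 + 1), ∑ u ∈ T, F κ' u * (straightCount N ν w (κ', u) : ℝ) := by
        refine sum_congr rfl fun κ' _ => sum_congr rfl fun u hu => ?_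
        simp only [hF, if_pos hu]; ring
    _ = contourSum N F ν w := h
    _ = contourSum N R ν w := hFR

end Contour

/-! ## §3 The pairing of the true weight: composite rows drop out on co-closed covectors -/

section Pairing

/-- [our object — local bookkeeping, no `def`] the UPPER BOX of a fine site `u` at blocking `N`, width `W`: the middle sites `t` with `u ∈ winF N W t` all lie in
`Π_i [u_i ∕ N − W, u_i ∕ N]` (an1 `mem_piFinset_of_mem_winF` gives `[(u_i − W) ∕ N, u_i ∕ N]`; `(u − W) ∕ N ≥ u ∕ N − W` for `N ≥ 1`). -/
theorem mem_upperBox_of_mem_winF {N W : ℕ} (hN : 0 < N) {u t : Site (3 + 1)} (h : u ∈ winF N W t) :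
    t ∈ Fintype.piFinset fun i => Finset.Icc (u i / (N : ℤ) - (W : ℤ)) (u i / (N : ℤ)) := by
  have h0 := mem_piFinset_of_mem_winF hN h
  rw [Fintype.mem_piFinset] at h0 ⊢
  intro i
  have hi := Finset.mem_Icc.1 (h0 i)
  refine Finset.mem_Icc.2 ⟨le_trans ?_ hi.1, hi.2⟩
  have hN' : (0 : ℤ) < (N : ℤ) := by exact_mod_cast hN
  apply Int.le_ediv_of_mul_le hN'
  have h1 : u i / (N : ℤ) * (N : ℤ) ≤ u i := Int.ediv_mul_le _ hN'.ne'
  have h2 : (W : ℤ) ≤ (W : ℤ) * (N : ℤ) := by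
    have : (1 : ℤ) ≤ (N : ℤ) := by exact_mod_cast hN
    nlinarith [Int.natCast_nonneg W]
  nlinarith

/-- [folklore] the upper box has `(W+1)^4` sites. -/
theorem card_upperBox (N W : ℕ) (u : Site (3 + 1)) :
    ((Fintype.piFinset fun i => Finset.Icc (u i / (N : ℤ) - (W : ℤ)) (u i / (N : ℤ))).card : ℝ) = ((W : ℝ) + 1) ^ (3 + 1) := by
  rw [Fintype.card_piFinset]
  have h : ∀ i : Fin (3 + 1), (Finset.Icc (u i / (N : ℤ) - (W : ℤ)) (u i / (N : ℤ))).card = W + 1 := fun i => by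
    rw [Int.card_Icc]; omega
  simp only [h, prod_const, card_univ, Fintype.card_fin]
  push_cast; ring

variable (Lc : ℕ) [NeZero Lc] (Q : StepRows 3 Lc) (sn : ℕ → ℝ)

/-- [folklore] the response column's absolute values are summable over the finest bonds (PART 97 `exists_abs_respCol_le` + lit `summable_exp_shift'`). -/
theorem summable_abs_respCol (s : ℝ) (n : ℕ) (μ : Fin (3 + 1)) (y : Site (3 + 1)) (κ' : Fin (3 + 1)) :
    Summable fun u : Site (3 + 1) => |respCol Lc Q s n μ y κ' u| := by
  obtain ⟨δ, C, hδ, hC, h⟩ := exists_abs_respCol_le Lc Q s n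
  refine Summable.of_nonneg_of_le (fun u => abs_nonneg _) (fun u => h μ y κ' u) ?_
  exact (ExpKernelCalculus.summable_exp_shift' hδ _).mul_left C

/-- [folklore] **`lip1_wFRec_of_lip1_compLinKer`** — THE PAIRING OF THE TRUE WEIGHT, GENERIC BRICK: if the brick family's composite kernel is bounded, and pairs on the bounded
co-closed covector `ψ` like `cm ·` the straight `Lc^(n+1)`-count (PART 20's conclusion shape, fed as `hrows`), then
`⟨ψ, wFRec … n μ y⟩ = cm · ⟨ψ, contourSum (Lc^(n+1)) (respCol … μ y)⟩`. -/
theorem lip1_wFRec_of_lip1_compLinKer {ℓ : Fin (3 + 1) → Site (3 + 1) → Bond (3 + 1) → ℝ} {Bℓ : ℝ} (hB : 0 ≤ Bℓ)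
    (hℓb : ∀ (μ : Fin (3 + 1)) (y : Site (3 + 1)) (f : Bond (3 + 1)), |ℓ μ y f| ≤ Bℓ)
    {ψ : Form1 (3 + 1) ℝ} {M : ℝ} (hψ : ∀ c t, |ψ c t| ≤ M) (n : ℕ) {cm : ℝ}
    (hrows : ∀ f : Bond (3 + 1), lip1 ψ (fun ν w => compLinKer (fun _ : ℕ => ℓ) Lc (n + 1) f (ν, w))
      = cm * lip1 ψ (fun ν w => (straightCount (Lc ^ (n + 1)) ν w f : ℝ)))
    (μ : Fin (3 + 1)) (y : Site (3 + 1)) :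
    lip1 ψ (fun c t => wFRec Lc Q ℓ sn n μ y c t) = cm * lip1 ψ (contourSum (Lc ^ (n + 1)) (respCol Lc Q (sn n) n μ y)) := by
  have hM : 0 ≤ M := (abs_nonneg _).trans (hψ 0 0)
  have hN : 0 < Lc ^ (n + 1) := pow_pos (Nat.pos_of_ne_zero (NeZero.ne Lc)) _
  have hR : ∀ κ', Summable fun u : Site (3 + 1) => |respCol Lc Q (sn n) n μ y κ' u| := fun κ' => summable_abs_respCol Lc Q (sn n) n μ y κ'
  -- (1) the composite kernel as a window kernel
  have hK1 : ∀ (f : Bond (3 + 1)) (c : Fin (3 + 1)) (t : Site (3 + 1)),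
      |compLinKer (fun _ : ℕ => ℓ) Lc (n + 1) f (c, t)| ≤ (((3 : ℝ) + 1) * (2 * (Lc : ℝ)) ^ (3 + 1) * Bℓ) ^ (n + 1) :=
    fun f c t => abs_compLinKer_le (ℓ := fun _ : ℕ => ℓ) (L := Lc) hB (fun _ μ' y' f' => hℓb μ' y' f') (n + 1) f (c, t)
  have hS1 : ∀ (f : Bond (3 + 1)) (c : Fin (3 + 1)) (t : Site (3 + 1)),
      t ∉ (Fintype.piFinset fun i => Finset.Icc (f.2 i / ((Lc ^ (n + 1) : ℕ) : ℤ) - (wid Lc (n + 1) : ℤ)) (f.2 i / ((Lc ^ (n + 1) : ℕ) : ℤ))) →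
        compLinKer (fun _ : ℕ => ℓ) Lc (n + 1) f (c, t) = 0 :=
    fun f c t ht => compLinKer_eq_zero (ℓ := fun _ : ℕ => ℓ) (n + 1) (f := f) (g := (c, t)) fun h => ht (mem_upperBox_of_mem_winF hN h)
  have e1 := tsum_swap_window (K := fun f c t => compLinKer (fun _ : ℕ => ℓ) Lc (n + 1) f (c, t)) (by positivity) hK1
    (fun f => Fintype.piFinset fun i => Finset.Icc (f.2 i / ((Lc ^ (n + 1) : ℕ) : ℤ) - (wid Lc (n + 1) : ℤ)) (f.2 i / ((Lc ^ (n + 1) : ℕ) : ℤ)))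
    (Cb := ((wid Lc (n + 1) : ℝ) + 1) ^ (3 + 1)) (fun f => (card_upperBox _ _ _).le) hS1 hM hψ hR
  -- (2) the straight count as a window kernel
  have hK2 : ∀ (f : Bond (3 + 1)) (c : Fin (3 + 1)) (t : Site (3 + 1)),
      |(straightCount (Lc ^ (n + 1)) c t f : ℝ)| ≤ ((Lc ^ (n + 1) : ℕ) : ℝ) ^ (3 + 1) * ((Lc ^ (n + 1) : ℕ) : ℝ) :=
    fun f c t => CoclosedCovectorCompositeRows.abs_straightCount_real_le (Lc ^ (n + 1)) c t f
  have hS2 : ∀ (f : Bond (3 + 1)) (c : Fin (3 + 1)) (t : Site (3 + 1)),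
      t ∉ (Fintype.piFinset fun i => Finset.Icc (f.2 i / ((Lc ^ (n + 1) : ℕ) : ℤ) - 1) (f.2 i / ((Lc ^ (n + 1) : ℕ) : ℤ))) →
        (straightCount (Lc ^ (n + 1)) c t f : ℝ) = 0 := by
    intro f c t ht
    rw [straightCount_eq_zero_of_not_near c (u := f) (fun h => ht (mem_piFinset_of_near hN h)), Int.cast_zero]
  have e2 := tsum_swap_window (K := fun f c t => (straightCount (Lc ^ (n + 1)) c t f : ℝ)) (by positivity) hK2
    (fun f => Fintype.piFinset fun i => Finset.Icc (f.2 i / ((Lc ^ (n + 1) : ℕ) : ℤ) - 1) (f.2 i / ((Lc ^ (n + 1) : ℕ) : ℤ)))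
    (Cb := (2 : ℝ) ^ (3 + 1)) (fun f => by rw [card_supportBox]; norm_num) hS2 hM hψ hR
  -- assemble
  unfold lip1
  have eW : ∀ t c, ψ c t * wFRec Lc Q ℓ sn n μ y c t
      = ψ c t * (∑ κ' : Fin (3 + 1), ∑' u : Site (3 + 1), compLinKer (fun _ : ℕ => ℓ) Lc (n + 1) (κ', u) (c, t) * respCol Lc Q (sn n) n μ y κ' u) :=
    fun t c => by rw [wFRec_eq]
  simp_rw [eW]
  rw [e1]
  have e3 : ∀ κ' u, respCol Lc Q (sn n) n μ y κ' u * (∑' t : Site (3 + 1), ∑ c : Fin (3 + 1), ψ c t * compLinKer (fun _ : ℕ => ℓ) Lc (n + 1) (κ', u) (c, t))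
      = cm * (respCol Lc Q (sn n) n μ y κ' u * (∑' t : Site (3 + 1), ∑ c : Fin (3 + 1), ψ c t * (straightCount (Lc ^ (n + 1)) c t (κ', u) : ℝ))) := by
    intro κ' u
    have h := hrows (κ', u)
    unfold lip1 at h
    rw [h]; ring
  simp_rw [e3, tsum_mul_left]
  rw [← Finset.mul_sum, ← e2]
  congr 1
  refine tsum_congr fun t => Finset.sum_congr rfl fun c _ => ?_
  rw [tsum_straightCount_mul_eq_contourSum (Lc ^ (n + 1)) (respCol Lc Q (sn n) n μ y) c t]

variable (R : Roots Lc)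

/-- [folklore] **`lip1_wFRec_rooted`** — at the ROOTED rows (`linKerAt (toSite (ctrOff 4 Lc)) Lc`): `⟨ψ, wFRec⟩ = ((Lc⁴)⁻¹)^(n+1) · ⟨ψ, contourSum (Lc^(n+1)) respCol⟩` for every
bounded co-closed middle covector `ψ` (PART 20 `lip1_compLinKer_linKerAt_of_bounded`). -/
theorem lip1_wFRec_rooted {ψ : Form1 (3 + 1) ℝ} {M : ℝ} (hψ : ∀ c t, |ψ c t| ≤ M) (hco : codiff₁ ψ = 0) (n : ℕ) (μ : Fin (3 + 1)) (y : Site (3 + 1)) :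
    lip1 ψ (fun c t => wFRec Lc Q (linKerAt (toSite (ctrOff (3 + 1) Lc)) Lc) sn n μ y c t)
      = ((((Lc : ℝ) ^ (3 + 1))⁻¹) ^ (n + 1)) * lip1 ψ (contourSum (Lc ^ (n + 1)) (respCol Lc Q (sn n) n μ y)) :=
  lip1_wFRec_of_lip1_compLinKer Lc Q sn (Bℓ := (ell (3 + 1) Lc : ℝ)) (by positivity)
    (fun μ' y' f => AveragingHessianKernelsRooted.abs_linKerAt_le (one_le_of_neZero Lc) μ' y' (ctrOff_mem_box (one_le_of_neZero Lc)) f) hψ n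
    (fun f => lip1_compLinKer_linKerAt_of_bounded hψ hco (Nat.pos_of_ne_zero (NeZero.ne Lc)) (r := fun _ : ℕ => ctrOff (3 + 1) Lc)
      (fun _ => ctrOff_mem_box (one_le_of_neZero Lc)) (n + 1) f) μ y

/-- [folklore] **`lip1_wFRec_sym`** — the same at the SYM rows of a root record `R` (PART 20 `lip1_compLinKer_symLinKerAt_of_bounded`; the two tokens have EQUAL bounded co-closed
moments, `lip1_compLinKer_symLinKerAt_eq_linKerAt_of_bounded`). -/
theorem lip1_wFRec_sym {ψ : Form1 (3 + 1) ℝ} {M : ℝ} (hψ : ∀ c t, |ψ c t| ≤ M) (hco : codiff₁ ψ = 0) (n : ℕ) (μ : Fin (3 + 1)) (y : Site (3 + 1)) :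
    lip1 ψ (fun c t => wFRec Lc Q (symLinKerAt (toSite R.r) Lc) sn n μ y c t)
      = ((((Lc : ℝ) ^ (3 + 1))⁻¹) ^ (n + 1)) * lip1 ψ (contourSum (Lc ^ (n + 1)) (respCol Lc Q (sn n) n μ y)) :=
  lip1_wFRec_of_lip1_compLinKer Lc Q sn (Bℓ := (ell (3 + 1) Lc : ℝ)) (by positivity)
    (fun μ' y' f => SymAveragingHessianCounts.abs_symLinKerAt_le (one_le_of_neZero Lc) μ' y' R.hr f) hψ n
    (fun f => lip1_compLinKer_symLinKerAt_of_bounded hψ hco (Nat.pos_of_ne_zero (NeZero.ne Lc)) (r := fun _ : ℕ => R.r)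
      (fun _ => R.hr) (n + 1) f) μ y

end Pairing

end Summit.QuantumFields.BalabanUV.Beta.FP.TowerFWeightCoclosedPairing

end
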